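import Summits.QuantumFields.YangMills.Theorems.DiagonalMirrorRPRWilsonDiagonalModelLiftedKernel

/-!
# Crux `DiagonalMirrorRPR` (stmt-QuantumFields-10604), line `sign-twisted-diagonal-trace`, construction F1_diag
# (director-ym O4 WORD 3 (A)), operator layer, step S2′: the lifted kernel RE-INDEXED BY `ℕ` (a measurable discrete factor)

Helper for the crux `DiagonalMirrorRPR` of `YangMills` (routes `IsotropyFromPowerCounting`, `MirrorModularBoosts`,
`PencilRigidity`; item stmt-QuantumFields-10604), attached `--supports … --as helper`; it closes nothing by itself.
Continuation of `…WilsonDiagonalModelLiftedKernel` (`liftedKernel ρ β` on `LiftIdx × HalfCfg`).  The feature index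
`LiftIdx = Σ n, (Fin n → Fin p)` is countable but carries no convenient measurable structure; to place the lifted kernel on an
honest s-finite measure space — `ℕ × (in-slab half layer)` with `counting ⊗ halfHaar` — the features are re-indexed by `ℕ`
along an injection `idxEmb : LiftIdx → ℕ`, extended by `0` off its range.

* `idxEmb`, `natFeature β k w` (`= φ_q(w)` if `k = idxEmb q`, else `0`), `natFeature_idxEmb`, `natFeature_of_not_exists`,
  ★ `hasSum_natFeature_mul` (`Σ_k ψ_k(w)ψ_k(w′) = exp(β⟨w,w′⟩)`), `hasSum_natFeature_sq`, `continuous_natFeature`;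
* ★ `natKernel ρ β` on `ℕ × HalfCfg` (`= liftedKernel` on the range: `natKernel_idxEmb`), ★ `natKernel_symm`,
  `continuous_natFeature_bondVec`, and the pointwise domination `exists_abs_natKernel_le`
  (`|𝔞((k,X),(k′,X′))| ≤ C ∫ |ψ_k(w(ΘY))| |ψ_{k′}(w(Y))| dY`).

Continuation `…NatKernelL2`: `𝔞 ∈ L²(counting ⊗ halfHaar)` (Jensen + Tonelli over the feature sums).  HONEST FRAMING: a
construction helper; no operator is built here yet, no `def wilsonDiagonalModel`; nothing about D_old ⟨10604⟩, the RP crux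
of the FOLD restate, or the summit is proved; the Yang–Mills mass gap is NOT proved here or anywhere in the tree.
-/

set_option autoImplicit false

noncomputable section

open MeasureTheory
open Literature.MathematicalPhysics.QuantumLattice Literature.MathematicalPhysics.QuantumFieldTheory
open Summit.QuantumFields.YangMills.Cruxes.DiagonalMirrorRPR.ParityBridgeColdTraces

namespace Summit.QuantumFields.YangMills.Cruxes.DiagonalMirrorRPR.SignTwistedDiagonalTrace.WilsonDiagonal

/-! ## §15 Re-indexing the features by `ℕ` (a measurable-friendly discrete factor) -/

section NatFeature

variable {p : ℕ}

/-- An injection of the exponential feature indices into `ℕ` (the index type is countable). -/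
def idxEmb (p : ℕ) : ExpIdx p → ℕ := (Countable.exists_injective_nat (ExpIdx p)).choose

/-- `idxEmb` is injective. -/
theorem idxEmb_injective (p : ℕ) : Function.Injective (idxEmb p) :=
  (Countable.exists_injective_nat (ExpIdx p)).choose_spec

/-- **ℕ-indexed exponential features**: `ψ_k = φ_q` if `k = idxEmb q`, and `0` off the range. -/
def natFeature (β : ℝ) (k : ℕ) (w : Fin p → ℝ) : ℝ :=
  Function.extend (idxEmb p) (fun q => expFeature β q w) 0 k

/-- On the range: `ψ_{idxEmb q} = φ_q`. -/
theorem natFeature_idxEmb (β : ℝ) (q : ExpIdx p) (w : Fin p → ℝ) :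
    natFeature β (idxEmb p q) w = expFeature β q w := by
  unfold natFeature
  exact (idxEmb_injective p).extend_apply _ _ q

/-- Off the range: `ψ_k = 0`. -/
theorem natFeature_of_not_exists (β : ℝ) {k : ℕ} (hk : ¬ ∃ q, idxEmb p q = k) (w : Fin p → ℝ) :
    natFeature β k w = 0 := by
  unfold natFeature
  rw [Function.extend_apply' _ _ _ hk, Pi.zero_apply]

/-- The product of two ℕ-indexed features is the zero extension of the product of the features. -/
theorem natFeature_mul_eq_extend (β : ℝ) (w w' : Fin p → ℝ) :
    (fun k => natFeature β k w * natFeature β k w') =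
      Function.extend (idxEmb p) (fun q => expFeature β q w * expFeature β q w') 0 := by
  funext k
  by_cases hk : ∃ q, idxEmb p q = k
  · obtain ⟨q, rfl⟩ := hk
    rw [natFeature_idxEmb, natFeature_idxEmb, (idxEmb_injective p).extend_apply]
  · rw [natFeature_of_not_exists β hk, Function.extend_apply' _ _ _ hk, Pi.zero_apply, zero_mul]

/-- ★ The feature lift, ℕ-indexed: `Σ_k ψ_k(w) ψ_k(w′) = exp(β⟨w, w′⟩)` (`β ≥ 0`). -/
theorem hasSum_natFeature_mul {β : ℝ} (hβ : 0 ≤ β) (w w' : Fin p → ℝ) :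
    HasSum (fun k : ℕ => natFeature β k w * natFeature β k w') (Real.exp (β * ∑ j, w j * w' j)) := by
  rw [natFeature_mul_eq_extend, hasSum_extend_zero (idxEmb_injective p)]
  exact hasSum_expFeature_mul_expFeature hβ w w'

/-- `Σ_k ψ_k(w)² = exp(β|w|²)`. -/
theorem hasSum_natFeature_sq {β : ℝ} (hβ : 0 ≤ β) (w : Fin p → ℝ) :
    HasSum (fun k : ℕ => natFeature β k w ^ 2) (Real.exp (β * ∑ j, w j ^ 2)) := by
  have h := hasSum_natFeature_mul hβ w w
  simp only [← sq] at h
  exact h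

/-- Continuity of each ℕ-indexed feature. -/
theorem continuous_natFeature (β : ℝ) (k : ℕ) : Continuous fun w : Fin p → ℝ => natFeature β k w := by
  by_cases hk : ∃ q, idxEmb p q = k
  · obtain ⟨q, rfl⟩ := hk
    simp only [natFeature_idxEmb]
    exact continuous_expFeature β q
  · simp only [natFeature_of_not_exists β hk]
    exact continuous_const

end NatFeature

/-! ## §16 The lifted kernel on `ℕ × (in-slab half layer)` -/

section NatKernel

variable {S : ℕ} [NeZero S] {G : Type*} [Group G] {Nc : ℕ} (ρ : G →* Matrix (Fin Nc) (Fin Nc) ℂ)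
variable [TopologicalSpace G] [IsTopologicalGroup G] [CompactSpace G] [MeasurableSpace G] [BorelSpace G]

/-- **The lifted kernel of the diagonal step, ℕ-indexed**: `𝔞((k,X),(k′,X′)) =
e^{β inslab(X)/2} e^{β inslab(X′)/2} ∫ ψ_k(w(ΘY)) exp(β · odd(X, Y, X′)) ψ_{k′}(w(Y)) dY` on `ℕ × HalfCfg` (zero off the range of
`idxEmb`); on the range it is `liftedKernel` (`natKernel_idxEmb`). -/
def natKernel (β : ℝ) (a b : ℕ × HalfCfg S S G) : ℝ :=
  Real.exp (β / 2 * inslabAction ρ a.2) * Real.exp (β / 2 * inslabAction ρ b.2) *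
    ∫ Y, natFeature β a.1 (bondVec ρ (thetaHalf Y)) * Real.exp (β * oddActionU ρ a.2 Y b.2) *
      natFeature β b.1 (bondVec ρ Y) ∂(halfHaar S G)

/-- On the range of `idxEmb` the ℕ-indexed kernel is the lifted kernel. -/
theorem natKernel_idxEmb (β : ℝ) (q q' : LiftIdx S Nc) (X X' : HalfCfg S S G) :
    natKernel ρ β (idxEmb _ q, X) (idxEmb _ q', X') = liftedKernel ρ β (q, X) (q', X') := by
  simp only [natKernel, liftedKernel, natFeature_idxEmb]

/-- ★ **The ℕ-indexed lifted kernel is symmetric.** -/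
theorem natKernel_symm (β : ℝ) (a b : ℕ × HalfCfg S S G) : natKernel ρ β a b = natKernel ρ β b a := by
  unfold natKernel
  rw [mul_comm (Real.exp (β / 2 * inslabAction ρ a.2)) (Real.exp (β / 2 * inslabAction ρ b.2))]
  congr 1
  conv_rhs => rw [← (measurePreserving_thetaEquiv (S := S) (G := G)).integral_comp']
  refine integral_congr_ae (ae_of_all _ fun Y => ?_)
  simp only [thetaEquiv_apply, thetaHalf_thetaHalf, oddActionU_reverse]
  ring

omit [CompactSpace G] [MeasurableSpace G] [BorelSpace G] in
/-- Each ℕ-indexed lifted feature `Y ↦ ψ_k(w(Y))` is continuous. -/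
theorem continuous_natFeature_bondVec (hρ : Continuous ρ) (β : ℝ) (k : ℕ) :
    Continuous fun Y : HalfCfg S S G => natFeature (p := featDim S Nc) β k (bondVec ρ Y) :=
  (continuous_natFeature β k).comp (continuous_bondVec ρ hρ)

variable [SecondCountableTopology G]

/-- **Pointwise domination** of the ℕ-indexed kernel: `|𝔞((k,X),(k′,X′))| ≤ C ∫ |ψ_k(w(ΘY))| |ψ_{k′}(w(Y))| dY`, `C` uniform. -/
theorem exists_abs_natKernel_le (hρ : Continuous ρ) (β : ℝ) :
    ∃ C : ℝ, 0 < C ∧ ∀ a b : ℕ × HalfCfg S S G,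
      |natKernel ρ β a b| ≤ C * ∫ Y, |natFeature (p := featDim S Nc) β a.1 (bondVec ρ (thetaHalf Y))| *
        |natFeature (p := featDim S Nc) β b.1 (bondVec ρ Y)| ∂(halfHaar S G) := by
  obtain ⟨Co, hCo, hodd⟩ := exists_exp_oddActionU_le (S := S) ρ hρ β
  obtain ⟨Ci, hCi, hins⟩ := exists_exp_inslabAction_le (S := S) ρ hρ β
  refine ⟨Ci * Ci * Co, by positivity, fun a b => ?_⟩
  rw [natKernel, abs_mul, abs_mul, abs_of_pos (Real.exp_pos _), abs_of_pos (Real.exp_pos _)]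
  set u : HalfCfg S S G → ℝ := fun Y => natFeature (p := featDim S Nc) β a.1 (bondVec ρ (thetaHalf Y)) with hu
  set v : HalfCfg S S G → ℝ := fun Y => natFeature (p := featDim S Nc) β b.1 (bondVec ρ Y) with hv
  have hcu : Continuous u := (continuous_natFeature_bondVec ρ hρ β a.1).comp continuous_thetaHalf
  have hcv : Continuous v := continuous_natFeature_bondVec ρ hρ β b.1
  have hint : |∫ Y, u Y * Real.exp (β * oddActionU ρ a.2 Y b.2) * v Y ∂(halfHaar S G)| ≤
      Co * ∫ Y, |u Y| * |v Y| ∂(halfHaar S G) := by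
    rw [← integral_const_mul]
    refine (abs_integral_le_integral_abs).trans (integral_mono_of_nonneg (ae_of_all _ fun Y => abs_nonneg _)
      ((integrable_of_continuous_halfHaar (hcu.abs.mul hcv.abs)).const_mul Co) (ae_of_all _ fun Y => ?_))
    dsimp only
    rw [abs_mul, abs_mul, abs_of_pos (Real.exp_pos _)]
    calc |u Y| * Real.exp (β * oddActionU ρ a.2 Y b.2) * |v Y| ≤ |u Y| * Co * |v Y| :=
          mul_le_mul_of_nonneg_right (mul_le_mul_of_nonneg_left (hodd _ _ _) (abs_nonneg _)) (abs_nonneg _)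
      _ = Co * (|u Y| * |v Y|) := by ring
  have hI0 : 0 ≤ ∫ Y, |u Y| * |v Y| ∂(halfHaar S G) := integral_nonneg fun Y => mul_nonneg (abs_nonneg _) (abs_nonneg _)
  calc Real.exp (β / 2 * inslabAction ρ a.2) * Real.exp (β / 2 * inslabAction ρ b.2) *
        |∫ Y, u Y * Real.exp (β * oddActionU ρ a.2 Y b.2) * v Y ∂(halfHaar S G)|
      ≤ Ci * Ci * (Co * ∫ Y, |u Y| * |v Y| ∂(halfHaar S G)) :=
        mul_le_mul (mul_le_mul (hins _) (hins _) (Real.exp_pos _).le hCi.le) hint (abs_nonneg _) (by positivity)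
    _ = Ci * Ci * Co * ∫ Y, |u Y| * |v Y| ∂(halfHaar S G) := by ring

end NatKernel

end Summit.QuantumFields.YangMills.Cruxes.DiagonalMirrorRPR.SignTwistedDiagonalTrace.WilsonDiagonal

end
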